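import Summits.BirchSwinnertonDyer.BirchSwinnertonDyer.Theses.SignedLowerHalves
import Summits.BirchSwinnertonDyer.Rank1Residual.Supersingular.KobayashiSqueezeReal
import Literature.NumberTheory.EllipticCurves.Kobayashi2003.SignedPAdicLFunctionUniqueProofs
import Literature.NumberTheory.EllipticCurves.Kobayashi2003.SignedSelmerDualUniquenessProofs
import Literature.NumberTheory.EllipticCurves.IwasawaCharCoeffNormProofs
import Literature.NumberTheory.EllipticCurves.ZpExtensionUnitTwistProofs
import Literature.NumberTheory.EllipticCurves.CyclotomicZpExtension
import Literature.NumberTheory.EllipticCurves.ComplexMultiplicationBurungaleFlachProofs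
import HarnessLib

/-!
# Crux `KobayashiLowerHalfSemistable` (route `SignedLowerHalves`, item 2 = stmt-BirchSwinnertonDyer-19000):
# the MODEL FORM («engine socket») of the typed Eisenstein half `KobayashiLowerDivisibility W p ε`

HONEST FRAMING (cell `bsd-ssimc`, README §4): theorems only; nothing here is a theorem about any curve;
the crux stays OPEN; BSD is not proved by any of this. What this file proves is STRUCTURAL and
UNCONDITIONAL: the crux's typed predicate does not depend on any of the auxiliary choices over which it
is universally quantified, so that ONE model suffices.

`KobayashiLowerDivisibility W p ε` (`Supersingular/KobayashiMainConjecture.lean`) quantifies UNIVERSALLY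
over: a cyclotomic `ℤ_p`-extension datum `κ` of `ℚ` with a topological generator `γ` matching the
cyclotomic variable (`κ.IsCyclotomic`, `κ.IsTopGenerator γ`, `IsCyclotomicVariable p γ`), the newform `f`
of `E = W` at level `N_E`, the period ratio `ϖ` (`ϖ·Ω_E = Ω⁺_f`), a Pollack pair `(L⁺, L⁻)` and a
Pontryagin-dual datum `D` of `Sel^ε(E/ℚ_∞)` (`Kobayashi2003.SignedSelmerDualData W κ γ ε`, an ABSTRACT
`Λ`-module pinned only through `toDual`, `T ↦ conj_γ − 1` and the action of constants). Any ENGINE that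
is to discharge the two binders the crux is closed modulo (`BurungaleSkinnerTianWan2024_thm13_scopedS_OPEN`
at `p ≥ 5`, `BSTW2024_lowerDivisibility_atThreeS_CELL` at `p = 3`; closer of record
`…Theorems.KobayashiLowerHalfSemistable_of_tiersS_C3`, p563654) constructs ONE such tuple — its own
`ℤ_p`-extension, generator, `p`-adic `L`-function and Selmer dual — and proves ONE divisibility. This
file is the adapter from that shape to the typed predicate:

* §1 `zpExtension_eq_of_normalised` — two NORMALISED cyclotomic data coincide: `κ' = κ` (both are unit
  twists of each other, `ZpExtension.IsCyclotomic.exists_eq_unitTwist_holds`; two cyclotomic variables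
  differ by an element of `ker κ`, `ZpExtension.IsCyclotomic.inv_mul_mem_kerSubgroup_of_isCyclotomicVariable`;
  `κ γ = 1 = κ' γ'` then forces the unit to be `1`);
* §2 `signedSelmerDualData_exists_of_inv_mul_mem_kerSubgroup` — change of `γ` inside its class
  `mod ker κ` for SIGNED dual data (signed copy of `SelmerDualData.exists_of_inv_mul_mem_kerSubgroup`:
  same module, same `Λ`-structure, since `conj_{γ'} = conj_γ` on `H¹(ℚ_∞, E[p^∞])`,
  `conjH1_mul_holds` / `conjH1_of_mem_holds`);
* §3 `signedSelmerDualData_charIdeal_eq` / `…_of_normalised` — `char_Λ X^ε(E/ℚ_∞)` is ONE ideal across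
  all data and all normalised `(κ, γ)` (`Kobayashi2003.SignedSelmerDualData.exists_linearEquiv` +
  `Module.charIdeal_eq_of_linearEquiv`), and so are `Λ`-torsion-ness and finite generation;
* §4 `kobayashiL_eq_of_isSignedPAdicLFunction` / `kobayashiL_eq_of_isPollackPair` — Kobayashi's `L_p^ε`
  is ONE element of `Λ`: the `ε`-member of any Pollack pair equals any solution of the sign-`ε` congruences
  (`IsSignedPAdicLFunction.unique`); the newform is unique (`IsNewformOf.unique`) and so is `ϖ`
  (`periodRatio_eq`, from `realPeriodRat_pos_holds`);
* §5 `kobayashiLowerDivisibility_of_model` (MAIN) and `kobayashiMainConjecture_of_model` — the typed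
  predicates from ONE model, whose analytic member is a SINGLE sign-`ε` function `L₀`
  (`IsSignedPAdicLFunction f₀ p ε L₀`; the opposite sign is never needed); §6
  `KobayashiLowerHalfSemistable_of_models` — the crux BY NAME from one model per X6 pair `(W, p)`, i.e. the
  exact shape a discharge of the binders has to deliver;
* §7 `kobayashiLowerDivisibility_iff_canonical` / `kobayashiMainConjecture_iff_canonical` — each typed
  predicate is EQUIVALENT to its canonical instance: the tree's cyclotomic datum
  `CyclotomicZp.zpExtension p`, any one normalised generator (`exists_normalised_generator`, from
  `CyclotomicZp.exists_isTopGenerator_zpExtension`) and the canonical dual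
  `Kobayashi2003.signedSelmerDualData` (`X = Hom(Sel^ε_∞, ℚ/ℤ)` with the forced `Λ`-action).

Nearest tree results: `…Theorems.kobayashiMainConjecture_of_exists` (p = 2 CM file; keeps the `∀ (κ, γ, f)`
and `∀ D` quantifiers — one `ϖ` and one Pollack pair per datum), `SelmerDualData.exists_of_inv_mul_mem_kerSubgroup`
and `IwasawaCharCoeffNormProofs` (the unsigned `X(E/ℚ_∞)`). New here: the signed `γ`-transport, the
rigidity `κ' = κ` of normalised cyclotomic data, and the one-tuple sockets for Kobayashi's predicates.

References: [Kobayashi2003] Def. 1.1, Conjecture (p. 2), Thm. 3.2 and (3.4)–(3.6) (p. 7);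
[Pollack2003] Prop. 6.18; [Washington1997] §13.1–13.2 (ℤ_p-extensions, `Aut ℤ_p = ℤ_pˣ`, characteristic
ideal up to `Λˣ`); [GreenbergLNM1716] §1 (the `Λ`-structure of `H¹(F_∞, E[p^∞])`);
[MazurTateTeitelbaum1986Invent] §I.13 (the cyclotomic variable).
-/

set_option autoImplicit false
set_option linter.dupNamespace false

noncomputable section

open scoped Classical MatrixGroups ModularForm

open CongruenceSubgroup WeierstrassCurve Literature.NumberTheory.EllipticCurves
  Literature.NumberTheory.EllipticCurves.ModularForms
  Literature.NumberTheory.EllipticCurves.Rank1Residual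
  Literature.NumberTheory.EllipticCurves.Kobayashi2003 ZpExtension
  Summit.BirchSwinnertonDyer.Rank1Residual.Supersingular

universe u

namespace Summit.BirchSwinnertonDyer.BirchSwinnertonDyer.Theorems.ModelForm

/-! ### §1 Rigidity of the normalised cyclotomic datum `(κ, γ)` over `ℚ` -/

section Rigidity

variable {p : ℕ} [Fact p.Prime]

/-- **Two normalised cyclotomic `ℤ_p`-extension data of `ℚ` are EQUAL.** If `κ, κ'` are cyclotomic
(`ker = χ_p⁻¹(μ(ℤ_p))`), `γ, γ'` are topological generators (`κ γ = 1 = κ' γ'`) and both match the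
cyclotomic variable (`χ_p(γ)·ζ = γ_cyc = χ_p(γ')·ζ'`), then `κ' = κ` as maps `Γ_ℚ →ₜ* ℤ_p`: `κ' = u • κ`
for a unit `u` (Washington §13.1, `Aut ℤ_p = ℤ_pˣ`), `γ⁻¹γ' ∈ ker κ` (Mazur–Tate–Teitelbaum §I.13), so
`κ γ' = κ γ = 1` and `1 = κ' γ' = u · κ γ' = u`. [cite: Washington1997, §13.1]
[cite: MazurTateTeitelbaum1986Invent, §I.13] -/
theorem zpExtension_eq_of_normalised {κ κ' : ZpExtension ℚ p} {γ γ' : Field.absoluteGaloisGroup ℚ}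
    (hκ : κ.IsCyclotomic) (hκ' : κ'.IsCyclotomic) (hγ : κ.IsTopGenerator γ)
    (hγ' : κ'.IsTopGenerator γ') (hv : IsCyclotomicVariable p γ) (hv' : IsCyclotomicVariable p γ') :
    κ' = κ := by
  obtain ⟨u, rfl⟩ := ZpExtension.IsCyclotomic.exists_eq_unitTwist_holds (κ := κ) hκ hκ'
  have hmem : γ⁻¹ * γ' ∈ κ.kerSubgroup :=
    ZpExtension.IsCyclotomic.inv_mul_mem_kerSubgroup_of_isCyclotomicVariable hκ hv hv'
  have h1 : κ (γ⁻¹ * γ') = 1 := ZpExtension.mem_kerSubgroup.mp hmem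
  rw [map_mul, map_inv, inv_mul_eq_one] at h1
  -- `h1 : κ γ = κ γ'`
  have hκγ : κ γ = Multiplicative.ofAdd 1 := hγ
  have hκγ' : κ γ' = Multiplicative.ofAdd 1 := h1 ▸ hκγ
  have hu : (κ.unitTwist u) γ' = Multiplicative.ofAdd 1 := hγ'
  rw [ZpExtension.unitTwist_apply, hκγ', toAdd_ofAdd, mul_one] at hu
  have hu1 : (u : ℤ_[p]) = 1 := Multiplicative.ofAdd.injective hu
  refine DFunLike.ext _ _ fun σ ↦ ?_
  rw [ZpExtension.unitTwist_apply, hu1, one_mul, ofAdd_toAdd]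

end Rigidity

/-! ### §2 Change of `γ` inside its class `mod ker κ` for SIGNED Pontryagin-dual data -/

section GammaChange

variable {K : Type u} [Field K] [NumberField K] (W : WeierstrassCurve K) {p : ℕ} [Fact p.Prime]
  (κ : ZpExtension K p) (ε : ℤˣ)

/-- Transport of the `γ`-dependent fields of a `SignedSelmerDualData` along an equality `c' = c` of
conjugation maps on `H¹(K_∞, E[p^∞])` (auxiliary, by `subst`; signed copy of the private helper of
`SelmerDualData.exists_of_inv_mul_mem_kerSubgroup`). [folklore] -/
private theorem exists_fields_of_conjH1_eq
    {c c' : W.subgroupH1 p κ.kerSubgroup →+ W.subgroupH1 p κ.kerSubgroup} (hc : c' = c)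
    (X : Type u) [AddCommGroup X] [Module (IwasawaAlgebra p) X]
    (conj_mem₀ : ∀ s ∈ signedSelmerInfty W κ ε, c s ∈ signedSelmerInfty W κ ε)
    (toDual₀ : X →+ (signedSelmerInfty W κ ε →+ AddCircle (1 : ℚ)))
    (hT₀ : ∀ (x : X) (s : signedSelmerInfty W κ ε),
      toDual₀ ((PowerSeries.X : IwasawaAlgebra p) • x) s =
        toDual₀ x ⟨c s, conj_mem₀ s s.2⟩ - toDual₀ x s) :
    ∃ (conj_mem : ∀ s ∈ signedSelmerInfty W κ ε, c' s ∈ signedSelmerInfty W κ ε),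
      ∀ (x : X) (s : signedSelmerInfty W κ ε),
        toDual₀ ((PowerSeries.X : IwasawaAlgebra p) • x) s =
          toDual₀ x ⟨c' s, conj_mem s s.2⟩ - toDual₀ x s := by
  subst hc
  exact ⟨conj_mem₀, hT₀⟩

/-- **Change of `γ` inside its class modulo `ker κ`, SIGNED version.** If `γ⁻¹γ' ∈ ker κ = Gal(K̄/K_∞)`,
a Pontryagin-dual datum of `Sel^ε(E/K_∞)` over `(κ, γ)` yields one over `(κ, γ')` with literally the same
Iwasawa module (same type `X`, same `Λ`-structure), hence the same characteristic ideal, `Λ`-torsion-ness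
and finite generation: elements of `Gal(K̄/K_∞)` act trivially on `H¹(K_∞, E[p^∞])` (`conjH1_of_mem_holds`,
Serre, *Local Fields* VII.§5 Prop. 3), so `conj_{γ'} = conj_γ ∘ conj_{γ⁻¹γ'} = conj_γ`
(`conjH1_mul_holds`) and `T = γ − 1 = γ' − 1` on `Sel^ε(E/K_∞)`. Signed copy of
`SelmerDualData.exists_of_inv_mul_mem_kerSubgroup`. [cite: GreenbergLNM1716, §1 p. 60]
[cite: Kobayashi2003, Def. 1.1 (the object only)] -/
theorem signedSelmerDualData_exists_of_inv_mul_mem_kerSubgroup {γ γ' : Field.absoluteGaloisGroup K}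
    (h : γ⁻¹ * γ' ∈ κ.kerSubgroup) (D : SignedSelmerDualData W κ γ ε) :
    ∃ D' : SignedSelmerDualData W κ γ' ε,
      D'.charIdeal = D.charIdeal ∧
      (Module.IsTorsion (IwasawaAlgebra p) D'.X ↔ Module.IsTorsion (IwasawaAlgebra p) D.X) ∧
      (Module.Finite (IwasawaAlgebra p) D'.X ↔ Module.Finite (IwasawaAlgebra p) D.X) := by
  have hconj : W.conjH1 p κ.kerSubgroup γ' = W.conjH1 p κ.kerSubgroup γ := by
    have hmul := W.conjH1_mul_holds p κ.kerSubgroup γ (γ⁻¹ * γ')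
    rw [mul_inv_cancel_left] at hmul
    rw [hmul, (W.conjH1_of_mem_holds p κ.kerSubgroup) h, AddMonoidHom.comp_id]
  obtain ⟨conj_mem, hT⟩ :=
    exists_fields_of_conjH1_eq W κ ε hconj D.X D.conj_mem D.toDual D.toDual_T_smul
  exact ⟨{ X := D.X, conj_mem := conj_mem, toDual := D.toDual, bijective := D.bijective,
           toDual_T_smul := hT, toDual_C_smul := D.toDual_C_smul }, rfl, Iff.rfl, Iff.rfl⟩

/-! ### §3 `char_Λ X^ε` is one ideal -/

variable {W κ ε}

/-- **`char_Λ X^ε(E/K_∞)` does not depend on the Pontryagin-dual datum** (fixed `(κ, γ, ε)`): two data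
are `Λ`-isomorphic (`Kobayashi2003.SignedSelmerDualData.exists_linearEquiv` — the `Λ`-action is FORCED by
`toDual`, `T ↦ conj_γ − 1` and the action of constants), and the characteristic ideal is an isomorphism
invariant (`Module.charIdeal_eq_of_linearEquiv`). In print: "`ℤ_p[[Γ]]` acts naturally on the
Pontryagin dual of `Sel^±(E/F_∞)`" (Kobayashi, p. 2) — there is only one such module.
[cite: Kobayashi2003, Def. 1.1 (sentence following it, p. 2)] [cite: Washington1997, §13.2] -/
theorem signedSelmerDualData_charIdeal_eq {γ : Field.absoluteGaloisGroup K}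
    (D D' : SignedSelmerDualData W κ γ ε) : D.charIdeal = D'.charIdeal := by
  obtain ⟨e, -⟩ := SignedSelmerDualData.exists_linearEquiv D D'
  exact Module.charIdeal_eq_of_linearEquiv e

end GammaChange

section Normalised

variable {p : ℕ} [Fact p.Prime] {W : WeierstrassCurve ℚ} {ε : ℤˣ}

/-- **`char_Λ X^ε(E/ℚ_∞)`, its `Λ`-torsion-ness and its finite generation are ONE invariant across all
NORMALISED cyclotomic instantiations `(κ, γ, D)`** (`κ` cyclotomic, `κ γ = 1`, `γ` matching the
cyclotomic variable; `D` any dual datum of `Sel^ε(E/ℚ_∞)` over `(κ, γ)`): `κ' = κ` (§1), `γ⁻¹γ' ∈ ker κ`,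
transport along `γ ↦ γ'` (§2), and datum-independence (§3). [cite: Washington1997, §13.2]
[cite: Kobayashi2003, Def. 1.1 (sentence following it, p. 2)] -/
theorem signedSelmerDualData_invariants_eq_of_normalised {κ κ' : ZpExtension ℚ p}
    {γ γ' : Field.absoluteGaloisGroup ℚ}
    (hκ : κ.IsCyclotomic) (hκ' : κ'.IsCyclotomic) (hγ : κ.IsTopGenerator γ)
    (hγ' : κ'.IsTopGenerator γ') (hv : IsCyclotomicVariable p γ) (hv' : IsCyclotomicVariable p γ')
    (D : SignedSelmerDualData W κ γ ε) (D' : SignedSelmerDualData W κ' γ' ε) :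
    D'.charIdeal = D.charIdeal ∧
      (Module.IsTorsion (IwasawaAlgebra p) D'.X ↔ Module.IsTorsion (IwasawaAlgebra p) D.X) ∧
      (Module.Finite (IwasawaAlgebra p) D'.X ↔ Module.Finite (IwasawaAlgebra p) D.X) := by
  obtain rfl : κ = κ' := (zpExtension_eq_of_normalised hκ hκ' hγ hγ' hv hv').symm
  obtain ⟨D₁, h₁, h₂, h₃⟩ := signedSelmerDualData_exists_of_inv_mul_mem_kerSubgroup W κ ε
    (ZpExtension.IsCyclotomic.inv_mul_mem_kerSubgroup_of_isCyclotomicVariable hκ hv hv') D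
  refine ⟨(signedSelmerDualData_charIdeal_eq D' D₁).trans h₁, ?_, ?_⟩
  · exact (SignedSelmerDualData.isTorsion_iff D' D₁).trans h₂
  · exact (SignedSelmerDualData.moduleFinite_iff D' D₁).trans h₃

/-! ### §4 The analytic side: `L_p^ε`, the newform and `ϖ` are unique -/

/-- **Kobayashi's `L_p^ε` is ONE element of `Λ`**: the `ε`-member `kobayashiL ε L⁺ L⁻` of any Pollack
pair of `f` equals any `L` satisfying the sign-`ε` half of the Mazur–Tate congruences
(`IsPollackPair.isSignedPAdicLFunction_kobayashiL`; those congruences determine an element of `Λ`,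
`IsSignedPAdicLFunction.unique`). [cite: Kobayashi2003, Thm. 3.2 and (3.4)–(3.5) (p. 7)] [cite: Pollack2003, Prop. 6.18] -/
theorem kobayashiL_eq_of_isSignedPAdicLFunction {N : ℕ} [NeZero N] {f : CuspForm (Gamma0 N) 2}
    {Lplus Lminus L : IwasawaAlgebra p} (hL : IsPollackPair f p Lplus Lminus) (ε : ℤˣ)
    (h : IsSignedPAdicLFunction f p ε L) : kobayashiL ε Lplus Lminus = L :=
  (hL.isSignedPAdicLFunction_kobayashiL ε).unique h

/-- In particular two Pollack pairs of the same form give the same `kobayashiL ε`.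
[cite: Kobayashi2003, Thm. 3.2 (p. 7)] [cite: Pollack2003, Prop. 6.18] -/
theorem kobayashiL_eq_of_isPollackPair {N : ℕ} [NeZero N] {f : CuspForm (Gamma0 N) 2}
    {Lplus Lminus Lplus' Lminus' : IwasawaAlgebra p} (hL : IsPollackPair f p Lplus Lminus)
    (hL' : IsPollackPair f p Lplus' Lminus') (ε : ℤˣ) :
    kobayashiL ε Lplus Lminus = kobayashiL ε Lplus' Lminus' :=
  kobayashiL_eq_of_isSignedPAdicLFunction hL ε (hL'.isSignedPAdicLFunction_kobayashiL ε)

/-- **The period ratio is unique**: `ϖ·Ω_E = Ω⁺_f = ϖ'·Ω_E` forces `ϖ = ϖ'`, because `Ω_E > 0`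
(`realPeriodRat_pos_holds`). [cite: CremonaAlgorithms1997, §3.7 (3.7.1)] -/
theorem periodRatio_eq [W.IsElliptic] {N : ℕ} {f : CuspForm (Gamma0 N) 2} {ϖ ϖ' : ℚ}
    (h : (ϖ : ℝ) * W.realPeriodRat = plusPeriod f) (h' : (ϖ' : ℝ) * W.realPeriodRat = plusPeriod f) :
    ϖ = ϖ' := by
  have hΩ : W.realPeriodRat ≠ 0 := ne_of_gt (W.realPeriodRat_pos_holds : 0 < W.realPeriodRat)
  exact_mod_cast mul_right_cancel₀ hΩ (h.trans h'.symm)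

/-! ### §5 MAIN — the typed Kobayashi predicates from ONE model -/

/-- **MODEL FORM («engine socket») of the Eisenstein half `KobayashiLowerDivisibility W p ε`.** Suppose ONE
model is given: a normalised cyclotomic datum `(κ₀, γ₀)` (`IsCyclotomic`, `IsTopGenerator`,
`IsCyclotomicVariable`), a newform `f₀` of `W` at level `N_E`, a period ratio `ϖ₀` (`ϖ₀·Ω_E = Ω⁺_{f₀}`),
ONE `L₀ ∈ Λ` satisfying the sign-`ε` congruences (`Kobayashi2003.IsSignedPAdicLFunction f₀ p ε L₀` — the
opposite sign is not needed; the `ε`-member of a Pollack pair qualifies,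
`IsPollackPair.isSignedPAdicLFunction_kobayashiL`), ONE Pontryagin-dual datum `D₀` of `Sel^ε(E/ℚ_∞)` over
`(κ₀, γ₀)`, and `g, h ∈ Λ` with `char X₀ = (g)` and `ι g = ϖ₀ · ι(L₀ · h)`. THEN the typed predicate holds,
i.e. the same divisibility holds for EVERY admissible `(κ, γ, f, ϖ, L⁺, L⁻, D)`: `κ = κ₀` and
`conj_γ = conj_{γ₀}` (§1–§2), `char X = char X₀` (§3), `f = f₀` (`IsNewformOf.unique`), `ϖ = ϖ₀` and
`L^ε = L₀` (§4). This is the shape in which any engine (BSTW at `p ≥ 5` / the cell chain at `p = 3`, once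
formalised) delivers the binder; unconditional as an implication, closes nothing by itself.
[cite: Kobayashi2003, Conjecture (Main Conjecture) (p. 2)] [cite: Washington1997, §13.2] -/
theorem kobayashiLowerDivisibility_of_model (W : WeierstrassCurve ℚ) [W.IsElliptic] [W.IsGloballyMinimal]
    (p : ℕ) [Fact p.Prime] (ε : ℤˣ) [NeZero (W.conductorNorm ℤ)]
    {κ₀ : ZpExtension ℚ p} {γ₀ : Field.absoluteGaloisGroup ℚ}
    (hκ₀ : κ₀.IsCyclotomic) (hγ₀ : κ₀.IsTopGenerator γ₀) (hv₀ : IsCyclotomicVariable p γ₀)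
    {f₀ : CuspForm (Gamma0 (W.conductorNorm ℤ)) 2} (hf₀ : IsNewformOf W f₀)
    {ϖ₀ : ℚ} (hϖ₀ : (ϖ₀ : ℝ) * W.realPeriodRat = plusPeriod f₀)
    {L₀ : IwasawaAlgebra p} (hL₀ : IsSignedPAdicLFunction f₀ p ε L₀)
    (D₀ : SignedSelmerDualData W κ₀ γ₀ ε) {g h : IwasawaAlgebra p}
    (hg : D₀.charIdeal = Ideal.span {g})
    (hgh : iwasawaToPowerSeries p g = PowerSeries.C (ϖ₀ : ℚ_[p]) * iwasawaToPowerSeries p (L₀ * h)) :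
    KobayashiLowerDivisibility W p ε := by
  intro κ γ hκ hγ hv _ f hf ϖ hϖ Lplus Lminus hL D
  obtain rfl : f = f₀ := hf.unique hf₀
  obtain rfl : ϖ = ϖ₀ := periodRatio_eq hϖ hϖ₀
  obtain ⟨hchar, -, -⟩ :=
    signedSelmerDualData_invariants_eq_of_normalised hκ₀ hκ hγ₀ hγ hv₀ hv D₀ D
  refine ⟨g, h, hchar.trans hg, ?_⟩
  rw [hgh, kobayashiL_eq_of_isSignedPAdicLFunction hL ε hL₀]

/-- **MODEL FORM of the full signed main conjecture `KobayashiMainConjecture W p ε`** (the predicate of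
crux 4 of the route and the conclusion of the binders `…thm13_…_OPEN`): ONE normalised cyclotomic datum,
the newform, ONE `ϖ₀`, ONE sign-`ε` function `L₀` and ONE dual datum `D₀` that is `Λ`-torsion with
`char X₀ = (g)`, `ι g = ϖ₀·ι L₀` give the typed statement for every admissible tuple (torsion-ness
transports by §3). [cite: Kobayashi2003, Conjecture (Main Conjecture) (p. 2)] [cite: Washington1997, §13.2] -/
theorem kobayashiMainConjecture_of_model (W : WeierstrassCurve ℚ) [W.IsElliptic] [W.IsGloballyMinimal]
    (p : ℕ) [Fact p.Prime] (ε : ℤˣ) [NeZero (W.conductorNorm ℤ)]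
    {κ₀ : ZpExtension ℚ p} {γ₀ : Field.absoluteGaloisGroup ℚ}
    (hκ₀ : κ₀.IsCyclotomic) (hγ₀ : κ₀.IsTopGenerator γ₀) (hv₀ : IsCyclotomicVariable p γ₀)
    {f₀ : CuspForm (Gamma0 (W.conductorNorm ℤ)) 2} (hf₀ : IsNewformOf W f₀)
    {ϖ₀ : ℚ} (hϖ₀ : (ϖ₀ : ℝ) * W.realPeriodRat = plusPeriod f₀)
    {L₀ : IwasawaAlgebra p} (hL₀ : IsSignedPAdicLFunction f₀ p ε L₀)
    (D₀ : SignedSelmerDualData W κ₀ γ₀ ε) (htors : Module.IsTorsion (IwasawaAlgebra p) D₀.X)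
    {g : IwasawaAlgebra p} (hg : D₀.charIdeal = Ideal.span {g})
    (hgL : iwasawaToPowerSeries p g = PowerSeries.C (ϖ₀ : ℚ_[p]) * iwasawaToPowerSeries p L₀) :
    KobayashiMainConjecture W p ε := by
  intro κ γ hκ hγ hv _ f hf ϖ hϖ Lplus Lminus hL D
  obtain rfl : f = f₀ := hf.unique hf₀
  obtain rfl : ϖ = ϖ₀ := periodRatio_eq hϖ hϖ₀
  obtain ⟨hchar, htor, -⟩ :=
    signedSelmerDualData_invariants_eq_of_normalised hκ₀ hκ hγ₀ hγ hv₀ hv D₀ D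
  refine ⟨htor.mpr htors, g, hchar.trans hg, ?_⟩
  rw [hgL, kobayashiL_eq_of_isSignedPAdicLFunction hL ε hL₀]

/-! ### §6 The crux BY NAME in model form -/

/-- **Crux 2 `KobayashiLowerHalfSemistable` from ONE MODEL PER X6 PAIR.** If for every globally minimal
`W`, odd `p` with `ClassX6 W p` (semistable, good supersingular, `p ≥ 5 ∨ a_3 = 0`) some sign `ε` admits a
model as in `kobayashiLowerDivisibility_of_model` — one normalised cyclotomic datum, the newform, one
`ϖ`, one sign-`ε` `p`-adic `L`-function `L₀`, one dual datum with `char X = (g)`, `ι g = ϖ·ι(L₀·h)` — then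
the crux holds BY NAME. This is the statement an engine formalisation has to produce, and nothing more.
Unconditional as an implication; the crux itself stays OPEN. [cite: Kobayashi2003, Conjecture (Main Conjecture) (p. 2)] -/
theorem KobayashiLowerHalfSemistable_of_models
    (hmodel : ∀ (W : WeierstrassCurve ℚ) [W.IsElliptic] [W.IsGloballyMinimal] (p : ℕ) [Fact p.Prime],
      p ≠ 2 → ClassX6 W p → ∀ [NeZero (W.conductorNorm ℤ)],
      ∃ (ε : ℤˣ) (κ₀ : ZpExtension ℚ p) (γ₀ : Field.absoluteGaloisGroup ℚ)
        (f₀ : CuspForm (Gamma0 (W.conductorNorm ℤ)) 2) (ϖ₀ : ℚ) (L₀ : IwasawaAlgebra p)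
        (D₀ : SignedSelmerDualData W κ₀ γ₀ ε) (g h : IwasawaAlgebra p),
        κ₀.IsCyclotomic ∧ κ₀.IsTopGenerator γ₀ ∧ IsCyclotomicVariable p γ₀ ∧ IsNewformOf W f₀ ∧
        (ϖ₀ : ℝ) * W.realPeriodRat = plusPeriod f₀ ∧ IsSignedPAdicLFunction f₀ p ε L₀ ∧
        D₀.charIdeal = Ideal.span {g} ∧
        iwasawaToPowerSeries p g = PowerSeries.C (ϖ₀ : ℚ_[p]) * iwasawaToPowerSeries p (L₀ * h)) :
    Summit.BirchSwinnertonDyer.BirchSwinnertonDyer.Theses.SignedLowerHalves.KobayashiLowerHalfSemistable := by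
  intro W _ _ p _ hp hX
  by_cases hN : NeZero (W.conductorNorm ℤ)
  · obtain ⟨ε, κ₀, γ₀, f₀, ϖ₀, L₀, D₀, g, h, hκ₀, hγ₀, hv₀, hf₀, hϖ₀, hL₀, hg, hgh⟩ :=
      hmodel W p hp hX
    exact ⟨ε, kobayashiLowerDivisibility_of_model W p ε hκ₀ hγ₀ hv₀ hf₀ hϖ₀ hL₀ D₀ hg hgh⟩
  · -- without `NeZero N_E` the predicate is vacuous in its newform binder
    exact ⟨1, fun κ γ _ _ _ hN' _ => absurd hN' hN⟩


/-! ### §7 The canonical instantiation: `κ_cyc`, any normalised `γ`, the canonical dual -/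

/-- A generator `γ` with `χ_p(γ) = γ_cyc` on the nose matches the cyclotomic variable (`ζ = 1`).
[cite: MazurTateTeitelbaum1986Invent, §I.13] -/
theorem isCyclotomicVariable_of_cyclotomicCharacter_eq {γ : Field.absoluteGaloisGroup ℚ}
    (h : ((Literature.NumberTheory.GaloisRepresentations.GaloisRep.cyclotomicCharacter ℚ p γ : ℤ_[p]ˣ) :
        ℤ_[p]) =
      (cyclotomicGenerator p : ℤ_[p])) : IsCyclotomicVariable p γ :=
  ⟨1, IsOfFinOrder.one, by rw [mul_one]; exact h⟩

/-- **The canonical normalised cyclotomic datum exists**: the tree's `κ_cyc = CyclotomicZp.zpExtension p`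
is cyclotomic and has a generator `γ` with `κ_cyc γ = 1` and `χ_p(γ) = γ_cyc`
(`CyclotomicZp.exists_isTopGenerator_zpExtension`). [cite: Washington1997, §13.1] -/
theorem exists_normalised_generator (p : ℕ) [Fact p.Prime] :
    ∃ γ : Field.absoluteGaloisGroup ℚ,
      (CyclotomicZp.zpExtension p).IsTopGenerator γ ∧ IsCyclotomicVariable p γ := by
  obtain ⟨γ, hγ, hχ⟩ := CyclotomicZp.exists_isTopGenerator_zpExtension (p := p)
  exact ⟨γ, hγ, isCyclotomicVariable_of_cyclotomicCharacter_eq hχ⟩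

/-- **`KobayashiLowerDivisibility W p ε` ⟺ its CANONICAL instance.** The typed Eisenstein half (all
`κ, γ, D`) is equivalent to the same divisibility for the canonical cyclotomic datum `κ_cyc`, any ONE of
its normalised generators `γ`, and the CANONICAL Pontryagin dual `Kobayashi2003.signedSelmerDualData W κ_cyc ε hγ`
(`X = Hom(Sel^ε_∞, ℚ/ℤ)` with the forced `Λ`-action): the universal quantification over the auxiliary
Iwasawa-theoretic choices carries no content (§1–§3). (The newform, `ϖ` and the Pollack pair stay
quantified on both sides; they are unique anyway, §4.) [cite: Kobayashi2003, Conjecture (Main Conjecture) (p. 2)]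
[cite: Washington1997, §13.2] -/
theorem kobayashiLowerDivisibility_iff_canonical (W : WeierstrassCurve ℚ) [W.IsElliptic]
    [W.IsGloballyMinimal] (p : ℕ) [Fact p.Prime] (ε : ℤˣ) :
    KobayashiLowerDivisibility W p ε ↔
      ∀ (γ : Field.absoluteGaloisGroup ℚ) (hγ : (CyclotomicZp.zpExtension p).IsTopGenerator γ),
        IsCyclotomicVariable p γ →
        ∀ [NeZero (W.conductorNorm ℤ)] (f : CuspForm (Gamma0 (W.conductorNorm ℤ)) 2),
          IsNewformOf W f → ∀ (ϖ : ℚ), (ϖ : ℝ) * W.realPeriodRat = plusPeriod f →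
        ∀ (Lplus Lminus : IwasawaAlgebra p), IsPollackPair f p Lplus Lminus →
          ∃ g h : IwasawaAlgebra p,
            (signedSelmerDualData W (CyclotomicZp.zpExtension p) ε hγ).charIdeal = Ideal.span {g} ∧
            iwasawaToPowerSeries p g =
              PowerSeries.C (ϖ : ℚ_[p]) * iwasawaToPowerSeries p (kobayashiL ε Lplus Lminus * h) := by
  refine ⟨fun H γ hγ hv _ f hf ϖ hϖ Lplus Lminus hL ↦
    H _ γ (CyclotomicZp.isCyclotomic_zpExtension p) hγ hv f hf ϖ hϖ Lplus Lminus hL _, fun H ↦ ?_⟩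
  intro κ γ hκ hγ hv _ f hf ϖ hϖ Lplus Lminus hL D
  obtain ⟨γ₀, hγ₀, hv₀⟩ := exists_normalised_generator p
  obtain ⟨g, h, hg, hgh⟩ := H γ₀ hγ₀ hv₀ f hf ϖ hϖ Lplus Lminus hL
  obtain ⟨hchar, -, -⟩ := signedSelmerDualData_invariants_eq_of_normalised
    (CyclotomicZp.isCyclotomic_zpExtension p) hκ hγ₀ hγ hv₀ hv
    (signedSelmerDualData W (CyclotomicZp.zpExtension p) ε hγ₀) D
  exact ⟨g, h, hchar.trans hg, hgh⟩

/-- **`KobayashiMainConjecture W p ε` ⟺ its CANONICAL instance** (torsion-ness and the equality of ideals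
for the canonical dual over `κ_cyc` and one normalised generator). [cite: Kobayashi2003, Conjecture (Main Conjecture) (p. 2)]
[cite: Washington1997, §13.2] -/
theorem kobayashiMainConjecture_iff_canonical (W : WeierstrassCurve ℚ) [W.IsElliptic]
    [W.IsGloballyMinimal] (p : ℕ) [Fact p.Prime] (ε : ℤˣ) :
    KobayashiMainConjecture W p ε ↔
      ∀ (γ : Field.absoluteGaloisGroup ℚ) (hγ : (CyclotomicZp.zpExtension p).IsTopGenerator γ),
        IsCyclotomicVariable p γ →
        ∀ [NeZero (W.conductorNorm ℤ)] (f : CuspForm (Gamma0 (W.conductorNorm ℤ)) 2),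
          IsNewformOf W f → ∀ (ϖ : ℚ), (ϖ : ℝ) * W.realPeriodRat = plusPeriod f →
        ∀ (Lplus Lminus : IwasawaAlgebra p), IsPollackPair f p Lplus Lminus →
          Module.IsTorsion (IwasawaAlgebra p)
              (signedSelmerDualData W (CyclotomicZp.zpExtension p) ε hγ).X ∧
            ∃ g : IwasawaAlgebra p,
              (signedSelmerDualData W (CyclotomicZp.zpExtension p) ε hγ).charIdeal = Ideal.span {g} ∧
              iwasawaToPowerSeries p g =
                PowerSeries.C (ϖ : ℚ_[p]) * iwasawaToPowerSeries p (kobayashiL ε Lplus Lminus) := by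
  refine ⟨fun H γ hγ hv _ f hf ϖ hϖ Lplus Lminus hL ↦
    H _ γ (CyclotomicZp.isCyclotomic_zpExtension p) hγ hv f hf ϖ hϖ Lplus Lminus hL _, fun H ↦ ?_⟩
  intro κ γ hκ hγ hv _ f hf ϖ hϖ Lplus Lminus hL D
  obtain ⟨γ₀, hγ₀, hv₀⟩ := exists_normalised_generator p
  obtain ⟨htors, g, hg, hgL⟩ := H γ₀ hγ₀ hv₀ f hf ϖ hϖ Lplus Lminus hL
  obtain ⟨hchar, htor, -⟩ := signedSelmerDualData_invariants_eq_of_normalised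
    (CyclotomicZp.isCyclotomic_zpExtension p) hκ hγ₀ hγ hv₀ hv
    (signedSelmerDualData W (CyclotomicZp.zpExtension p) ε hγ₀) D
  exact ⟨htor.mpr htors, g, hchar.trans hg, hgL⟩

end Normalised

end Summit.BirchSwinnertonDyer.BirchSwinnertonDyer.Theorems.ModelForm

end
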